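import Summits.CriticalPhenomena.SAWScalingLimit.Theorems.HexTight.Negative.OutwardDiveDefs

/-!
# Ring counterexamples for crux `HexTight` (stmt-CriticalPhenomena-5423), part 8:
the two self-avoiding walks of the ring domain `Ω_1`

Line lead seat c6 (2026-08-16), re-deriving the lost part 4/5 of the disprover's weighted-ring
chain (cdisprove generation 3; its `RingTwoSAW.lean` bounced only because the gate restarted in
flight and was never resubmitted). Over the landed parts (`LatticeG2Ring`: the ring `ring K`;
`LatticeG2Routes`: the right route inside `Tpos` of length `≤ 8K`; `RingDegree`: forced progression
and `leftward_long`; `RingDomain`: the ring as the discrete domain `Ω_1 = Omega K`;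
`OutwardDiveDefs`: transfer and weights) we prove:

* distances along the bottom row right of the centre `x₀ = c(U(0,0))`: `dist(U(i,0)) = i`,
  `i < dist(D(i,0)) < i + 1` (`dist_U0`, `lt_dist_D0`, `dist_D0_lt`), and the classification of the
  bottom-row cells with real part `≥ Re x₀ + 1/2` (`eq_U_or_D_of_right`);
* every SAW of `Ω_1` from `U(0,0)` to `U(0,2K)` has support `U(0,0) :: D(0,0) :: …` (rightward) or
  `U(0,0) :: D(-1,0) :: …` (leftward) (`saw_snd_dichotomy`); two SAWs with the same second cell are
  equal (`saw_eq_of_snd_eq`, forced progression); a rightward SAW `γR` with support in `Tpos` and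
  `ℓ(γR) ≤ 8K + 1` exists (`exists_right_saw`); leftward SAWs have `ℓ ≥ 14K - 1`
  (`vertexCount_of_left`);
* hence the total `x_c`-weight of all SAWs is at most `x_c^{ℓ(γR)} + x_c^{14K-1}` (`weight_le`).

Consumed by `Negative/OutwardDiveFalse.lean` (`not_outwardDiveBoundAsTyped`,
`not_pinnedReturnBoundAsTyped`).
-/

noncomputable section

open scoped BigOperators ENNReal
open Classical
open Literature.Probability.LatticeModels
open Literature.Probability.RandomPlanarGeometry.SAW

namespace Summit.CriticalPhenomena.SAWScalingLimit.Cruxes.HexTight.Negative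

/-! ## Distances along the bottom row, right of the centre -/

/-- `c(U(i,0)) - x₀ = i` (same height as the centre). -/
theorem center_U0_sub (i : ℤ) : hexCenter (U i 0) - x₀ = ((i : ℝ) : ℂ) := by
  apply Complex.ext
  · rw [Complex.sub_re, re_U, x₀_re, Complex.ofReal_re]; push_cast; ring
  · rw [Complex.sub_im, im_U, x₀_im, Complex.ofReal_im]; push_cast; ring

/-- **`dist(c(U(i,0)), x₀) = i`** for `i ≥ 0`. -/
theorem dist_U0 {i : ℤ} (hi : 0 ≤ i) : dist (hexCenter (U i 0)) x₀ = i := by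
  rw [Complex.dist_eq, center_U0_sub, Complex.norm_real, Real.norm_eq_abs,
    abs_of_nonneg (by exact_mod_cast hi)]

/-- `dist(c(D(i,0)), x₀)² = (i + 1/2)² + 1/12`. -/
theorem dist_D0_sq (i : ℤ) : dist (hexCenter (D i 0)) x₀ ^ 2 = ((i : ℝ) + 1 / 2) ^ 2 + 1 / 12 := by
  rw [Complex.dist_eq, Complex.sq_norm, Complex.normSq_apply, Complex.sub_re, Complex.sub_im, re_D,
    im_D, x₀_re, x₀_im]
  have h3 : Real.sqrt 3 * Real.sqrt 3 = 3 := Real.mul_self_sqrt (by norm_num)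
  push_cast
  nlinarith [h3]

/-- **`i < dist(c(D(i,0)), x₀)`** for `i ≥ 0`. -/
theorem lt_dist_D0 {i : ℤ} (hi : 0 ≤ i) : (i : ℝ) < dist (hexCenter (D i 0)) x₀ := by
  have hi' : (0 : ℝ) ≤ i := by exact_mod_cast hi
  refine lt_of_pow_lt_pow_left₀ 2 dist_nonneg ?_
  rw [dist_D0_sq]
  nlinarith

/-- **`dist(c(D(i,0)), x₀) < i + 1`** for `i ≥ 0`. -/
theorem dist_D0_lt {i : ℤ} (hi : 0 ≤ i) : dist (hexCenter (D i 0)) x₀ < i + 1 := by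
  have hi' : (0 : ℝ) ≤ i := by exact_mod_cast hi
  refine lt_of_pow_lt_pow_left₀ 2 (by linarith) ?_
  rw [dist_D0_sq]
  nlinarith

/-- **Classification.** A bottom-row cell with real part `≥ Re x₀ + 1/2` is `U(i,0)` with `i ≥ 1`
or `D(i,0)` with `i ≥ 0`. -/
theorem eq_U_or_D_of_right {y : HexVertex} (hy0 : y.1 1 = 0)
    (hre : x₀.re + 1 / 2 ≤ (hexCenter y).re) :
    (∃ i : ℤ, 1 ≤ i ∧ y = U i 0) ∨ (∃ i : ℤ, 0 ≤ i ∧ y = D i 0) := by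
  rw [x₀_re] at hre
  rcases face_eq y with hyU | hyD
  · left
    rw [hy0] at hyU
    refine ⟨y.1 0, ?_, hyU⟩
    rw [hyU, re_U] at hre
    push_cast at hre
    have : (0 : ℝ) < y.1 0 := by linarith
    exact_mod_cast (show (0 : ℤ) < y.1 0 by exact_mod_cast this)
  · right
    rw [hy0] at hyD
    refine ⟨y.1 0, ?_, hyD⟩
    rw [hyD, re_D] at hre
    push_cast at hre
    have : (-1 : ℝ) < y.1 0 := by linarith
    have : (-1 : ℤ) < y.1 0 := by exact_mod_cast this
    omega

/-! ## SAWs of `Ω_1` from the centre `U(0,0)`: support facts -/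

section SAWs

variable {K : ℕ}

/-- the centre is a ring cell -/
theorem U00_mem_ring (hK : 1 ≤ K) : U 0 0 ∈ ring K :=
  U_mem_ring.2 (Or.inl ⟨rfl, by omega, by omega⟩)

/-- the top cell `U(0,2K)` is a ring cell (`K ≥ 1`) -/
theorem U02K_mem_ring (hK : 1 ≤ K) : U 0 (2 * K) ∈ ring K :=
  U_mem_ring.2 (Or.inr (Or.inr (Or.inl ⟨rfl, by omega, by omega⟩)))

/-- the support of a SAW of `Ω_1` is a lattice chain -/
theorem saw_isChain {a b : HexVertex} (γ : HexDomainSAW (Omega K) 1 a b) :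
    γ.walk.support.IsChain hexGraph.Adj :=
  List.IsChain.imp (fun _ _ h => (domAdj_imp h).1) γ.walk.isChain_adj_support

/-- the support of a SAW of `Ω_1` from a ring cell lies in the ring -/
theorem saw_support_ring {a b : HexVertex} (ha : a ∈ ring K) (γ : HexDomainSAW (Omega K) 1 a b) :
    ∀ y ∈ γ.walk.support, y ∈ ring K :=
  support_subset_ring ha γ.walk

/-- two SAWs of `Ω_1` with the same support are equal -/
theorem saw_eq_of_support_eq {a b : HexVertex} {γ γ' : HexDomainSAW (Omega K) 1 a b}
    (h : γ.walk.support = γ'.walk.support) : γ = γ' := by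
  obtain ⟨w, hw⟩ := γ
  obtain ⟨w', hw'⟩ := γ'
  simp only at h
  cases SimpleGraph.Walk.ext_support h
  rfl

/-- `ℓ(γ)` is the number of cells of the support -/
theorem vertexCount_eq_length_support {a b : HexVertex} (γ : HexDomainSAW (Omega K) 1 a b) :
    γ.vertexCount = γ.walk.support.length := by
  rw [EmbDomainSAW.vertexCount, EmbDomainSAW.length, SimpleGraph.Walk.length_support]

/-- **Second-cell dichotomy.** A SAW of `Ω_1` from the centre to a different cell starts
`U(0,0), D(0,0), …` (rightward) or `U(0,0), D(-1,0), …` (leftward): the third lattice neighbour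
`D(0,-1)` of the centre is not a ring cell. -/
theorem saw_snd_dichotomy {b : HexVertex} (hb : b ≠ U 0 0) (γ : HexDomainSAW (Omega K) 1 (U 0 0) b) :
    ∃ t : List HexVertex,
      γ.walk.support = U 0 0 :: D 0 0 :: t ∨ γ.walk.support = U 0 0 :: D (-1) 0 :: t := by
  obtain ⟨w, hw⟩ := γ
  cases w with
  | nil => exact absurd rfl hb
  | @cons _ n _ hadj p =>
    obtain ⟨hadj', -, hn⟩ := domAdj_imp hadj
    have hs : (SimpleGraph.Walk.cons hadj p).support = U 0 0 :: n :: p.support.tail := by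
      rw [SimpleGraph.Walk.support_cons, p.cons_tail_support]
    refine ⟨p.support.tail, ?_⟩
    rw [hs]
    rcases adj_U_iff.1 hadj' with rfl | rfl | rfl
    · exact Or.inl rfl
    · right; simp
    · exfalso
      rw [D_mem_ring] at hn
      omega

/-- **Forced progression for SAWs.** Two SAWs of `Ω_1` from the centre to the same cell with the
same second cell are equal (`eq_of_chains_last`). -/
theorem saw_eq_of_snd_eq (hK : 1 ≤ K) {b n : HexVertex} {γ γ' : HexDomainSAW (Omega K) 1 (U 0 0) b}
    {t t' : List HexVertex} (h : γ.walk.support = U 0 0 :: n :: t)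
    (h' : γ'.walk.support = U 0 0 :: n :: t') : γ = γ' := by
  have hc : (U 0 0 :: n :: t).IsChain hexGraph.Adj := h ▸ saw_isChain γ
  have hc' : (U 0 0 :: n :: t').IsChain hexGraph.Adj := h' ▸ saw_isChain γ'
  have hn : (U 0 0 :: n :: t).Nodup := h ▸ γ.isPath.support_nodup
  have hn' : (U 0 0 :: n :: t').Nodup := h' ▸ γ'.isPath.support_nodup
  have hr : ∀ y ∈ U 0 0 :: n :: t, y ∈ ring K := h ▸ saw_support_ring (U00_mem_ring hK) γ
  have hr' : ∀ y ∈ U 0 0 :: n :: t', y ∈ ring K := h' ▸ saw_support_ring (U00_mem_ring hK) γ'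
  have hl : (U 0 0 :: n :: t).getLast (List.cons_ne_nil _ _) = b := by
    have := γ.walk.getLast_support
    simp only [h] at this
    exact this
  have hl' : (U 0 0 :: n :: t').getLast (List.cons_ne_nil _ _) = b := by
    have := γ'.walk.getLast_support
    simp only [h'] at this
    exact this
  have htt : t = t' := eq_of_chains_last hK hc hc' hn hn' hr hr' (hl.trans hl'.symm)
  subst htt
  exact saw_eq_of_support_eq (h.trans h'.symm)

/-- **The right SAW exists**: a SAW of `Ω_1` from `U(0,0)` to `U(0,2K)` with support in `Tpos`
(real parts `≥ Re x₀`) and at most `8K + 1` cells — the right route of `LatticeG2Routes`,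
transferred to `Ω_1` and made self-avoiding by `bypass`. -/
theorem exists_right_saw (hK : 1 ≤ K) :
    ∃ γR : HexDomainSAW (Omega K) 1 (U 0 0) (U 0 (2 * K)),
      (∀ y ∈ γR.walk.support, y ∈ Tpos K) ∧ γR.vertexCount ≤ 8 * K + 1 := by
  obtain ⟨p, hpL, hp⟩ := joined_rightLen hK
  obtain ⟨q, hq⟩ := domWalk_transfer hK Tpos_subset p hp
  refine ⟨⟨q.bypass, q.bypass_isPath⟩, fun y hy => hp y (hq ▸ q.support_bypass_subset_support hy), ?_⟩
  have hlen : q.length = p.length := by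
    have h1 := q.length_support
    rw [hq, p.length_support] at h1
    omega
  have h2 := q.length_bypass_le_length
  show q.bypass.length + 1 ≤ 8 * K + 1
  omega

/-- the second cell of a SAW with support in `Tpos` is `D(0,0)` (`D(-1,0)` has real part
`0 < Re x₀`) -/
theorem snd_eq_of_Tpos (hK : 1 ≤ K) (γ : HexDomainSAW (Omega K) 1 (U 0 0) (U 0 (2 * K)))
    (hT : ∀ y ∈ γ.walk.support, y ∈ Tpos K) :
    ∃ t : List HexVertex, γ.walk.support = U 0 0 :: D 0 0 :: t := by
  have hb : U 0 (2 * (K : ℤ)) ≠ U 0 0 := fun h => by have := (U_inj h).2; omega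
  obtain ⟨t, h | h⟩ := saw_snd_dichotomy hb γ
  · exact ⟨t, h⟩
  · exfalso
    have hmem : D (-1) 0 ∈ γ.walk.support := by rw [h]; simp
    have := (hT _ hmem).2
    rw [x₀_re, re_D] at this
    push_cast at this
    linarith

/-- **Leftward SAWs are long**: a SAW `U(0,0), D(-1,0), …, U(0,2K)` has at least `14K - 1` cells
(`leftward_long`). -/
theorem vertexCount_of_left (hK : 1 ≤ K) (γ : HexDomainSAW (Omega K) 1 (U 0 0) (U 0 (2 * K)))
    {t : List HexVertex} (h : γ.walk.support = U 0 0 :: D (-1) 0 :: t) :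
    14 * K ≤ γ.vertexCount + 1 := by
  have hc : (U 0 0 :: D (-1) 0 :: t).IsChain hexGraph.Adj := h ▸ saw_isChain γ
  have hn : (U 0 0 :: D (-1) 0 :: t).Nodup := h ▸ γ.isPath.support_nodup
  have hr : ∀ y ∈ U 0 0 :: D (-1) 0 :: t, y ∈ ring K := h ▸ saw_support_ring (U00_mem_ring hK) γ
  have hl : (U 0 0 :: D (-1) 0 :: t).getLast (List.cons_ne_nil _ _) = U 0 (2 * K) := by
    have := γ.walk.getLast_support
    simp only [h] at this
    exact this
  have hlong := leftward_long hK hc hn hr hl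
  rw [vertexCount_eq_length_support, h]
  simp only [List.length_cons]
  omega

/-- **Dichotomy.** Given a rightward SAW `γR`, every SAW of `Ω_1` from `U(0,0)` to `U(0,2K)` is
`γR` or has at least `14K - 1` cells. -/
theorem saw_dichotomy (hK : 1 ≤ K) {γR : HexDomainSAW (Omega K) 1 (U 0 0) (U 0 (2 * K))}
    {tR : List HexVertex} (hR : γR.walk.support = U 0 0 :: D 0 0 :: tR)
    (γ : HexDomainSAW (Omega K) 1 (U 0 0) (U 0 (2 * K))) : γ = γR ∨ 14 * K ≤ γ.vertexCount + 1 := by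
  have hb : U 0 (2 * (K : ℤ)) ≠ U 0 0 := fun h => by have := (U_inj h).2; omega
  obtain ⟨t, h | h⟩ := saw_snd_dichotomy hb γ
  · exact Or.inl (saw_eq_of_snd_eq hK h hR)
  · exact Or.inr (vertexCount_of_left hK γ h)

/-- Two SAWs other than the rightward one coincide (both are leftward; forced progression). -/
theorem saw_eq_of_ne_right (hK : 1 ≤ K) {γR : HexDomainSAW (Omega K) 1 (U 0 0) (U 0 (2 * K))}
    {tR : List HexVertex} (hR : γR.walk.support = U 0 0 :: D 0 0 :: tR)
    {γ γ' : HexDomainSAW (Omega K) 1 (U 0 0) (U 0 (2 * K))} (hγ : γ ≠ γR) (hγ' : γ' ≠ γR) :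
    γ = γ' := by
  have hb : U 0 (2 * (K : ℤ)) ≠ U 0 0 := fun h => by have := (U_inj h).2; omega
  obtain ⟨t, h | h⟩ := saw_snd_dichotomy hb γ
  · exact absurd (saw_eq_of_snd_eq hK h hR) hγ
  obtain ⟨t', h' | h'⟩ := saw_snd_dichotomy hb γ'
  · exact absurd (saw_eq_of_snd_eq hK h' hR) hγ'
  exact saw_eq_of_snd_eq hK h h'

/-! ## The weight of all SAWs -/

/-- **Weight bound.** Given a rightward SAW `γR`, the total `x_c`-weight of any set of SAWs of
`Ω_1` from `U(0,0)` to `U(0,2K)` is at most `x_c^{ℓ(γR)} + x_c^{14K-1}`: every other SAW is the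
(unique) leftward one, of `≥ 14K - 1` cells. -/
theorem weight_le (hK : 1 ≤ K) {γR : HexDomainSAW (Omega K) 1 (U 0 0) (U 0 (2 * K))}
    {tR : List HexVertex} (hR : γR.walk.support = U 0 0 :: D 0 0 :: tR)
    (S : Set (HexDomainSAW (Omega K) 1 (U 0 0) (U 0 (2 * K)))) :
    hexSAWWeight (Omega K) 1 (U 0 0) (U 0 (2 * K)) S ≤
      ENNReal.ofReal (hexCriticalFugacity ^ γR.vertexCount) +
        ENNReal.ofReal (hexCriticalFugacity ^ (14 * K - 1)) := by
  refine (MeasureTheory.measure_mono (Set.subset_univ S)).trans ?_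
  rw [weight_apply]
  simp only [Set.indicator_univ]
  rw [← Finset.add_sum_erase _ _ (Finset.mem_univ γR)]
  refine add_le_add le_rfl ?_
  have hcard : (Finset.univ.erase γR).card ≤ 1 := by
    refine Finset.card_le_one.2 fun γ hγ γ' hγ' => ?_
    exact saw_eq_of_ne_right hK hR (Finset.ne_of_mem_erase hγ) (Finset.ne_of_mem_erase hγ')
  have hle : ∀ γ ∈ Finset.univ.erase γR, ENNReal.ofReal (hexCriticalFugacity ^ γ.vertexCount) ≤
      ENNReal.ofReal (hexCriticalFugacity ^ (14 * K - 1)) := by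
    intro γ hγ
    refine ENNReal.ofReal_le_ofReal ?_
    rcases saw_dichotomy hK hR γ with h | h
    · exact absurd h (Finset.ne_of_mem_erase hγ)
    · exact pow_le_pow_of_le_one hexCriticalFugacity_pos_lt_one.1.le hexCriticalFugacity_pos_lt_one.2.le (by omega)
  refine (Finset.sum_le_card_nsmul _ _ _ hle).trans ?_
  calc (Finset.univ.erase γR).card • ENNReal.ofReal (hexCriticalFugacity ^ (14 * K - 1))
      ≤ 1 • ENNReal.ofReal (hexCriticalFugacity ^ (14 * K - 1)) :=
        nsmul_le_nsmul_left (by positivity) hcard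
    _ = _ := one_nsmul _

/-- **Lower bound by one element.** The weight of a set containing `γ` is at least `x_c^{ℓ(γ)}`. -/
theorem le_weight_of_mem {a b : HexVertex} {S : Set (HexDomainSAW (Omega K) 1 a b)}
    {γ : HexDomainSAW (Omega K) 1 a b} (hγ : γ ∈ S) :
    ENNReal.ofReal (hexCriticalFugacity ^ γ.vertexCount) ≤ hexSAWWeight (Omega K) 1 a b S := by
  rw [← embWeight_singleton]
  exact MeasureTheory.measure_mono (Set.singleton_subset_iff.2 hγ)

/-- **The arithmetic of the refutation.** With `ℓ(γR) ≤ 8K + 1` and `K ≥ 1` the inequality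
`2 x_c^{ℓ(γR)} ≤ x_c^{ℓ(γR)} + x_c^{14K-1}` is false (`x_c^{ℓ(γR)} > x_c^{14K-1}` as `0 < x_c < 1`
and `8K + 1 < 14K - 1`). -/
theorem not_two_mul_le (hK : 1 ≤ K) {n : ℕ} (hn : n ≤ 8 * K + 1) :
    ¬ 2 * ENNReal.ofReal (hexCriticalFugacity ^ n) ≤
      ENNReal.ofReal (hexCriticalFugacity ^ n) + ENNReal.ofReal (hexCriticalFugacity ^ (14 * K - 1)) := by
  intro h
  rw [two_mul, ENNReal.add_le_add_iff_left ENNReal.ofReal_ne_top,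
    ENNReal.ofReal_le_ofReal_iff (pow_nonneg hexCriticalFugacity_pos_lt_one.1.le _)] at h
  have hlt : hexCriticalFugacity ^ (14 * K - 1) < hexCriticalFugacity ^ n :=
    pow_lt_pow_right_of_lt_one₀ hexCriticalFugacity_pos_lt_one.1 hexCriticalFugacity_pos_lt_one.2 (by omega)
  exact absurd h (not_le.2 hlt)

end SAWs

end Summit.CriticalPhenomena.SAWScalingLimit.Cruxes.HexTight.Negative

end
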